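import Mathlib.Analysis.Calculus.MeanValue
import Literature.Analysis.FunctionSpaces.HolderNorm
import HarnessLib

/-!
# Discharged fact: smooth functions on the flat torus are `C^{k,α}` for `α ≤ 1`

`Literature.Analysis.FunctionSpaces.HolderNorm` records as a named fact
(`Literature.Torus.IsSmooth.memContDiffHolder : Prop`) that a smooth function `f : T^d → Y` lies in
`C^{k,r}(T^d, Y)` for every `k : ℕ` and every exponent `r ≤ 1`, where membership is that of the
periodic lift `Torus.lift f : ℝ^d → Y` in `C^{k,r}_b(ℝ^d, Y)` (`Literature.Analysis.FunctionSpaces.MemContDiffHolder`: `C^k`, all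
derivatives `D^j (lift f)`, `j ≤ k`, bounded, `D^k (lift f)` `r`-Hölder). This file proves it
(`Literature.Analysis.FunctionSpaces.Torus.IsSmooth.memContDiffHolder_holds`), so users holding
`(h : Torus.IsSmooth.memContDiffHolder)` can discharge the hypothesis.

The Hölder-space conventions are those of De Lellis–Székelyhidi, *Dissipative continuous Euler
flows* (arXiv:1202.1751 = Invent. Math. 193 (2013)), §5 "Schauder estimates" of the arXiv version,
p. 11: `‖f‖₀ = sup_{T³} |f|`, `[f]_m = max_{|β| = m} ‖D^β f‖₀`,
`[f]_{m+α} = max_{|β| = m} sup_{x ≠ y} |D^β f (x) - D^β f (y)| / |x - y|^α`,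
`‖f‖_{m+α} = ∑_{j ≤ m} [f]_j + [f]_{m+α}`, together with the "elementary inequality"
`[f]_s ≤ C (ε^{r-s} [f]_r + ε^{-s} ‖f‖₀)` for `r ≥ s ≥ 0` recalled there; with `r = k + 1`,
`s = k + α`, `ε = 1` it says exactly that `[f]_{k+α}` is controlled by `‖D^{k+1} f‖₀ + ‖f‖₀`,
finite for smooth periodic `f`.

## Proof

* `Torus.iteratedFDeriv_lift`: `D^n (lift f) = lift (x ↦ D^n (liftAt f x) 0)` (translation
  invariance of `iteratedFDeriv`, Mathlib `iteratedFDeriv_comp_add_left`), so every derivative of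
  the lift is itself the lift of a function on the compact torus, continuous by
  `Torus.continuous_lift_iff`; hence bounded (`Torus.IsSmooth.eSupNorm_iteratedFDeriv_lift_lt_top`).
* `D^k (lift f)` is differentiable with `‖fderiv (D^k (lift f)) x‖ = ‖D^{k+1} (lift f) x‖`
  (`norm_fderiv_iteratedFDeriv`), so it is Lipschitz by the mean value inequality
  (`lipschitzWith_of_nnnorm_fderiv_le`): `Torus.IsSmooth.lipschitzWith_iteratedFDeriv_lift`.
* A bounded Lipschitz map is `r`-Hölder for every `r ≤ 1` (`LipschitzWith.holderWith_of_enorm_le`: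
  constant `L + 2M`, splitting `edist x y ≤ 1` / `≥ 1`).

## References

* C. De Lellis, L. Székelyhidi Jr., *Dissipative continuous Euler flows*, Invent. Math. 193
  (2013), 377–407, arXiv:1202.1751, §5 (arXiv numbering), p. 11 (Hölder norms on `T³`,
  interpolation inequality `[f]_s ≤ C(ε^{r-s}[f]_r + ε^{-s}‖f‖₀)`).
* D. Gilbarg, N. Trudinger, *Elliptic PDE of second order* (2001), §4.1 (Hölder spaces `C^{k,α}`).
-/

open Set Topology
open scoped NNReal ENNReal

noncomputable section

/-! ## Bounded Lipschitz maps are Hölder of every exponent `≤ 1` -/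

/-- A Lipschitz map with constant `L` into a seminormed group whose values are bounded by `M` is
`r`-Hölder with constant `L + 2 M` for every `r ≤ 1`: for `edist x y ≤ 1` use
`edist x y ≤ (edist x y)^r`, for `edist x y ≥ 1` use `‖g x - g y‖ ≤ 2M ≤ 2M (edist x y)^r`
(Gilbarg–Trudinger §4.1, the inclusions `C^{0,1} ⊆ C^{0,α}` on bounded sets, made global by the
sup-norm bound). Deliberately placed in Mathlib's `LipschitzWith` namespace for dot notation.
[folklore] -/
theorem LipschitzWith.holderWith_of_enorm_le {X G : Type*} [PseudoEMetricSpace X]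
    [SeminormedAddCommGroup G] {L M r : ℝ≥0} {g : X → G} (hL : LipschitzWith L g)
    (hM : ∀ x, ‖g x‖ₑ ≤ M) (hr : r ≤ 1) : HolderWith (L + 2 * M) r g := by
  intro x y
  rcases le_total (edist x y) 1 with h | h
  · calc edist (g x) (g y) ≤ L * edist x y := hL x y
      _ ≤ (L + 2 * M : ℝ≥0) * edist x y ^ (r : ℝ) := by
        gcongr
        · exact_mod_cast le_self_add
        · calc edist x y = edist x y ^ (1 : ℝ) := (ENNReal.rpow_one _).symm
            _ ≤ edist x y ^ (r : ℝ) :=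
              ENNReal.rpow_le_rpow_of_exponent_ge h (by exact_mod_cast hr)
  · calc edist (g x) (g y) = ‖g x - g y‖ₑ := edist_eq_enorm_sub _ _
      _ ≤ ‖g x‖ₑ + ‖g y‖ₑ := enorm_sub_le
      _ ≤ M + M := add_le_add (hM x) (hM y)
      _ = (2 * M : ℝ≥0) * (1 : ℝ≥0∞) := by rw [mul_one, two_mul, ENNReal.coe_add]
      _ ≤ (L + 2 * M : ℝ≥0) * edist x y ^ (r : ℝ) := by
        gcongr
        · exact_mod_cast le_add_self
        · calc (1 : ℝ≥0∞) = edist x y ^ (0 : ℝ) := ENNReal.rpow_zero.symm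
            _ ≤ edist x y ^ (r : ℝ) := ENNReal.rpow_le_rpow_of_exponent_le h r.2

namespace Literature.Analysis.FunctionSpaces

namespace Torus

variable {d : Type*} [Fintype d] {Y : Type*} [NormedAddCommGroup Y] [NormedSpace ℝ Y]

/-- The derivatives of the periodic lift are periodic lifts: `D^n (lift f) y = D^n (liftAt f (proj y)) 0`,
i.e. `D^n (lift f) = lift (x ↦ D^n (liftAt f x) 0)` (translation invariance of the iterated
derivative; Grafakos §3.1 for calculus on `T^n` via periodic functions). [folklore] -/
theorem iteratedFDeriv_lift (f : UnitAddTorus d → Y) (n : ℕ) :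
    iteratedFDeriv ℝ n (lift f) = lift (fun x => iteratedFDeriv ℝ n (liftAt f x) 0) := by
  funext y
  simp only [lift_apply]
  rw [liftAt_proj, Function.comp_def, iteratedFDeriv_comp_add_left, add_zero]

variable {f : UnitAddTorus d → Y}

/-- For a smooth `f : T^d → Y`, the function `x ↦ D^n (liftAt f x) 0` on the torus (whose lift is
`D^n (lift f)`) is continuous. [folklore] -/
theorem IsSmooth.continuous_iteratedFDeriv_liftAt (hf : IsSmooth f) (n : ℕ) :
    Continuous fun x : UnitAddTorus d => iteratedFDeriv ℝ n (Torus.liftAt f x) 0 := by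
  rw [← continuous_lift_iff, ← iteratedFDeriv_lift]
  exact hf.continuous_iteratedFDeriv (by exact_mod_cast le_top)

/-- All derivatives of the periodic lift of a smooth function on the torus are bounded:
`‖D^n (lift f)‖_∞ < ∞` (they are lifts of continuous functions on the compact torus;
De Lellis–Székelyhidi, arXiv:1202.1751 §5, p. 11: `[f]_n < ∞` for smooth `f` on `T³`). [folklore] -/
theorem IsSmooth.eSupNorm_iteratedFDeriv_lift_lt_top (hf : IsSmooth f) (n : ℕ) :
    eSupNorm (iteratedFDeriv ℝ n (lift f)) < ∞ := by
  obtain ⟨M, hM⟩ :=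
    (isCompact_range (hf.continuous_iteratedFDeriv_liftAt n).norm).isBounded.bddAbove
  rw [eSupNorm_lt_top_iff]
  refine ⟨M, fun y => hM ⟨proj y, ?_⟩⟩
  rw [iteratedFDeriv_lift, lift_apply]

/-- The `k`-th derivative of the periodic lift of a smooth function on the torus is Lipschitz,
with constant `‖D^{k+1} (lift f)‖_∞` (mean value inequality, `‖fderiv (D^k g)‖ = ‖D^{k+1} g‖`).
[folklore] -/
theorem IsSmooth.lipschitzWith_iteratedFDeriv_lift (hf : IsSmooth f) (k : ℕ) :
    LipschitzWith (eSupNorm (iteratedFDeriv ℝ (k + 1) (lift f))).toNNReal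
      (iteratedFDeriv ℝ k (lift f)) := by
  have hne := (hf.eSupNorm_iteratedFDeriv_lift_lt_top (k + 1)).ne
  refine lipschitzWith_of_nnnorm_fderiv_le (𝕜 := ℝ)
    (hf.differentiable_iteratedFDeriv (by exact_mod_cast ENat.coe_lt_top k)) fun x => ?_
  rw [← ENNReal.coe_le_coe, ENNReal.coe_toNNReal hne, ← enorm_eq_nnnorm, ← ofReal_norm,
    norm_fderiv_iteratedFDeriv, ofReal_norm]
  exact enorm_le_eSupNorm _ x

/-- The `k`-th derivative of the periodic lift of a smooth function on the torus is `r`-Hölder for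
every `r ≤ 1` (bounded and Lipschitz). [folklore] -/
theorem IsSmooth.memHolder_iteratedFDeriv_lift (hf : IsSmooth f) (k : ℕ) {r : ℝ≥0} (hr : r ≤ 1) :
    MemHolder r (iteratedFDeriv ℝ k (lift f)) := by
  have hne := (hf.eSupNorm_iteratedFDeriv_lift_lt_top k).ne
  refine ⟨_, (hf.lipschitzWith_iteratedFDeriv_lift k).holderWith_of_enorm_le
    (M := (eSupNorm (iteratedFDeriv ℝ k (lift f))).toNNReal) (fun x => ?_) hr⟩
  rw [ENNReal.coe_toNNReal hne]
  exact enorm_le_eSupNorm _ x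

/-- Discharge of the named fact `Torus.IsSmooth.memContDiffHolder`: smooth functions on the torus
are `C^{k,r}` for every `k : ℕ` and every `r ≤ 1` — the lift is `C^k`, its derivatives of all
orders are bounded (lifts of continuous functions on the compact torus), and `D^k (lift f)` is
Lipschitz and bounded, hence `r`-Hölder for `r ≤ 1`. In the conventions of De Lellis–Székelyhidi
(arXiv:1202.1751, §5 "Schauder estimates", p. 11; Invent. Math. 193 (2013)) this is the
finiteness of `‖f‖_{k+α} = ∑_{j ≤ k} [f]_j + [f]_{k+α}` for smooth `f`, an instance of the
elementary inequality `[f]_s ≤ C(ε^{r-s} [f]_r + ε^{-s} ‖f‖₀)` (`r = k+1`, `s = k+α`, `ε = 1`)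
recalled there.
[cite: DeLellisSzekelyhidiInvent2013, §5 (arXiv numbering) p. 11, Hölder norms and the elementary interpolation inequality] -/
theorem IsSmooth.memContDiffHolder_holds : IsSmooth.memContDiffHolder (d := d) (Y := Y) := by
  intro r f hf k hr
  unfold MemContDiffHolder Literature.Analysis.FunctionSpaces.MemContDiffHolder
  exact ⟨hf.isContDiff (by exact_mod_cast le_top),
    fun j _ => hf.eSupNorm_iteratedFDeriv_lift_lt_top j, hf.memHolder_iteratedFDeriv_lift k hr⟩

end Torus

end Literature.Analysis.FunctionSpaces

end
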